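import Literature.AnabelianGeometry.SemiGraphs.SgAFiniteEtaleCoveringOrbits
import Literature.AnabelianGeometry.SemiGraphs.CoveringGraphPointLift
import HarnessLib

/-!
# [SemiAnbd] Def. 2.2 (i) on the profinite presentation: the underlying semi-graph of a finite étale
# covering IS the orbit semi-graph of the attached object of `B^cov` (bridge brick L1c-iso, proof-only)

Mochizuki, *Semi-graphs of anabelioids*, Publ. RIMS **42** (2006), Def. 2.2 (i) p. 23: the finite étale
covering `𝒢' → 𝒢` attached to `G' = {S_v, T_e, ψ_b} ∈ Ob(B(𝒢))` "lies over some proper morphism of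
semi-graphs: the vertices (respectively, edges) of `𝔾'` that lie over a vertex `v` (respectively, an
edge `e`) correspond to the connected components of `S_v` (respectively, `T_e`)", a branch of the edge of
a component `Q ⊆ T_e` abutting to the vertex of the component `P ⊆ S_v` under which `Q` lies via `ψ_b`;
Def. 3.5 (i) p. 37: the covering `G_S → G` of an object of `B^cov(G)` (orbits, abc-iut-L3-t2's
`CovObj.coveringSemiGraph`) (kurims `paper:url-f33ace170ff4`). [cite: MochizukiSemiAnbd2006, Def. 2.2(i) p.23]

PROOF-ONLY brick of the (R1) bridge law L1 (HOME/staging/L3/L3-t3/R1-BRIDGE-SHAPES.md §4; interface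
owner abc-iut-L3-t3), over L1b `SgAFiniteEtaleCoveringOrbits.lean` and the t2-level lift
`CoveringGraphPointLift.lean` (`CovObj.pointLift`, `CovObj.GlueCondition`).  For the local data of
`Hom.IsFiniteEtaleCoveringOf` (component labels `cV`, `cE`, their bijectivity clauses, the clause
"`Q` lies under `P` via `ψ_b`") and ANY system of points `y_w ∈ F_{f w}(P_w)`, `z_{e'} ∈ F_{f e'}(Q_{e'})`
in the fibre-images of the labelled components:

* `BObj.toCovObj_glue_apply` — the gluing of `BObj.toCovObj A` (B6) on points:
  `t ↦ α_b(F_e(ψ_b⁻¹) t)` (`rfl`);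
* `BObj.glue_castPtE_mem_range_of_fac` — "`Q` lies under `P` via `ψ_b`" ⇒ the gluing carries the
  fibre-image of `Q` into the fibre-image of `P`;
* `HomOver.glueCondition_toCovObj` — hence such a point system satisfies the GLUING CONDITION of
  `CovObj.pointLift` at `S := BObj.toCovObj A`;
* `HomOver.pointLift_vertex_bijective` / `pointLift_edge_bijective` — and `w ↦ (f w, [y_w])`,
  `e' ↦ (f e', [z_{e'}])` are BIJECTIONS onto the vertices / edges of the covering semi-graph
  (components ↔ orbits, `exists_orbitOfComponent_bijective` of L1b);
* `HomOver.exists_pointLiftIso_of_isFiniteEtaleCoveringOf` — packaged: for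
  `φ.toHom.IsFiniteEtaleCoveringOf A` there are such points, WITH the stabiliser dictionary of L1a
  (`range Π_{𝒢,w} → Π_{ℋ,f w} = Stab(y_w)`), for which the lift is an ISOMORPHISM of semi-graphs
  `𝒢.graph ≅ 𝔾_{toCovObj A}` over `f`.

Nothing of the paper is asserted; no side taken on [IUTchIII] Cor. 3.12.
-/

noncomputable section

namespace Literature.AnabelianGeometry.SemiGraphs

open CategoryTheory CategoryTheory.Limits CategoryTheory.PreGaloisCategory
open Literature.AnabelianGeometry.Anabelioids

universe u

namespace SemiGraphOfAnabelioids

variable {𝒢 ℋ : SemiGraphOfAnabelioids.{u, u, u}}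

/-! ### The gluing of `toCovObj A` on points -/

namespace BObj

/-- **The gluing `F_e(T_e) ≅ b^* F_v(S_v)` of `toCovObj A` on points** (B6: `(α_b)⁻¹ ≫ F_e(ψ_b)`,
inverted): `t ↦ α_b(F_e(ψ_b⁻¹)(t))`, `α_b` the chosen path `b^* ⋙ F_e ≅ F_v` (B1 `branchPath`).
[cite: MochizukiSemiAnbd2006, Def 3.5(i) p.37] -/
theorem toCovObj_glue_apply (A : ℋ.BObj) (b : ℋ.graph.Branch) (v : ℋ.graph.Vertex)
    (h : ℋ.graph.abuts b = some v) (t : (ℋ.fibE (ℋ.graph.edgeOf b)).obj (A.T (ℋ.graph.edgeOf b))) :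
    ((toCovObj A).glue b v h).hom.hom.hom t =
      (ℋ.branchPath b v h).hom.app (A.S v) ((ℋ.fibE (ℋ.graph.edgeOf b)).map (A.ψ b v h).inv t) :=
  rfl

/-- The orbit relation of the vertex fibre `F_v(S_v)` of `toCovObj A` is the `Aut F_v`-orbit relation.
[cite: MochizukiSemiAnbd2006, Def 3.5(i) p.37] -/
theorem toCovObj_clV_eq_iff (A : ℋ.BObj) (v : ℋ.graph.Vertex) (x x' : (ℋ.fibV v).obj (A.S v)) :
    BTemp.cl ((toCovObj A).SV v) x = BTemp.cl ((toCovObj A).SV v) x' ↔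
      x' ∈ MulAction.orbit (Aut (ℋ.fibV v)) x := by
  rw [BTemp.cl_eq_cl_iff, MulAction.mem_orbit_iff]
  exact Iff.rfl

/-- The orbit relation of the edge fibre `F_e(T_e)` of `toCovObj A` is the `Aut F_e`-orbit relation.
[cite: MochizukiSemiAnbd2006, Def 3.5(i) p.37] -/
theorem toCovObj_clE_eq_iff (A : ℋ.BObj) (e : ℋ.graph.Edge) (x x' : (ℋ.fibE e).obj (A.T e)) :
    BTemp.cl ((toCovObj A).SE e) x = BTemp.cl ((toCovObj A).SE e) x' ↔
      x' ∈ MulAction.orbit (Aut (ℋ.fibE e)) x := by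
  rw [BTemp.cl_eq_cl_iff, MulAction.mem_orbit_iff]
  exact Iff.rfl

/-- **"`Q` lies under `P` via `ψ_b`" on fibres**: if the component `Q ⊆ T_{e₂}` (`e₂` a presentation
of the edge of `b`) factors through `ψ_b(b^* P)` — the last clause of `Hom.IsFiniteEtaleCoveringOf`,
with its transport `transportE` along `edgeOf b = e₂` — then the gluing of `toCovObj A` along `b`
carries the fibre-image of `Q` into the fibre-image of `P`. [cite: MochizukiSemiAnbd2006, Def. 2.2(i) p.23] -/
theorem glue_castPtE_mem_range_of_fac (A : ℋ.BObj) {b : ℋ.graph.Branch} {v : ℋ.graph.Vertex}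
    (h : ℋ.graph.abuts b = some v) {e₂ : ℋ.graph.Edge} (he : ℋ.graph.edgeOf b = e₂)
    (P : Subobject (A.S v)) (Q : Subobject (A.T e₂))
    (hfac : ∃ fac : (Q : ℋ.E e₂) ⟶
        (ℋ.transportE he).obj ((ℋ.pull b v h).pullback.obj (P : ℋ.V v)),
      fac ≫ (ℋ.transportE he).map ((ℋ.pull b v h).pullback.map P.arrow ≫ (A.ψ b v h).hom) ≫
          eqToHom (ℋ.transportE_obj_T A he) = Q.arrow)
    (q : (ℋ.fibE e₂).obj (Q : ℋ.E e₂)) :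
    (((toCovObj A).glue b v h).hom.hom.hom
        ((toCovObj A).castPtE he.symm ((ℋ.fibE e₂).map Q.arrow q)) : (ℋ.fibV v).obj (A.S v)) ∈
      Set.range ((ℋ.fibV v).map P.arrow) := by
  subst he
  obtain ⟨fac, hfac⟩ := hfac
  change (ℋ.branchPath b v h).hom.app (A.S v)
      ((ℋ.fibE (ℋ.graph.edgeOf b)).map (A.ψ b v h).inv ((ℋ.fibE _).map Q.arrow q)) ∈ _
  have hfac' : Q.arrow = fac ≫ (ℋ.pull b v h).pullback.map P.arrow ≫ (A.ψ b v h).hom := by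
    rw [← hfac]
    change fac ≫ ((ℋ.pull b v h).pullback.map P.arrow ≫ (A.ψ b v h).hom) ≫ eqToHom rfl = _
    rw [eqToHom_refl, Category.comp_id]
  refine ⟨(ℋ.branchPath b v h).hom.app (P : ℋ.V v) ((ℋ.fibE (ℋ.graph.edgeOf b)).map fac q), ?_⟩
  have hnat := NatTrans.naturality_apply (ℋ.branchPath b v h).hom P.arrow
    ((ℋ.fibE (ℋ.graph.edgeOf b)).map fac q)
  rw [← hnat, hfac']
  congr 1
  change ((ℋ.fibE _).map fac ≫ (ℋ.fibE _).map ((ℋ.pull b v h).pullback.map P.arrow)) q =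
    ((ℋ.fibE _).map (fac ≫ (ℋ.pull b v h).pullback.map P.arrow ≫ (A.ψ b v h).hom) ≫
      (ℋ.fibE _).map (A.ψ b v h).inv) q
  rw [← Functor.map_comp, ← Functor.map_comp, Category.assoc, Category.assoc, Iso.hom_inv_id,
    Category.comp_id]

end BObj

/-! ### The gluing condition and the bijections for the local data of a finite étale covering -/

namespace HomOver

variable {f : 𝒢.graph ⟶ ℋ.graph} {A : ℋ.BObj}
  (cV : ∀ w : 𝒢.graph.Vertex, π₀Obj (A.S (f.vertexMap w)))
  (cE : ∀ e' : 𝒢.graph.Edge, π₀Obj (A.T (f.edgeMap e')))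
  (y : ∀ w : 𝒢.graph.Vertex, (ℋ.fibV (f.vertexMap w)).obj (A.S (f.vertexMap w)))
  (z : ∀ e' : 𝒢.graph.Edge, (ℋ.fibE (f.edgeMap e')).obj (A.T (f.edgeMap e')))

/-- **The gluing condition holds** for a system of points in the fibre-images of the labelled
components, given the clause "the component `cE e'` lies under `cV w` via `ψ_b`" (`b = f b'`, `b'` a
branch of `e'` abutting to `w`) of the local description. [cite: MochizukiSemiAnbd2006, Def. 2.2(i) p.23] -/
theorem glueCondition_toCovObj
    (hfac : ∀ (b' : 𝒢.graph.Branch) (w : 𝒢.graph.Vertex) (h' : 𝒢.graph.abuts b' = some w),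
      ∃ fac : ((cE (𝒢.graph.edgeOf b')).1 : ℋ.E (f.edgeMap (𝒢.graph.edgeOf b'))) ⟶
          (ℋ.transportE (f.edgeOf_branchMap b')).obj
            ((ℋ.pull (f.branchMap b') (f.vertexMap w)
              (f.abuts_branchMap b' w h')).pullback.obj ((cV w).1 : ℋ.V (f.vertexMap w))),
        fac ≫ (ℋ.transportE (f.edgeOf_branchMap b')).map
              ((ℋ.pull _ _ (f.abuts_branchMap b' w h')).pullback.map (cV w).1.arrow ≫
                (A.ψ (f.branchMap b') (f.vertexMap w) (f.abuts_branchMap b' w h')).hom) ≫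
            eqToHom (ℋ.transportE_obj_T A (f.edgeOf_branchMap b')) =
          (cE (𝒢.graph.edgeOf b')).1.arrow)
    (hy : ∀ w, y w ∈ Set.range ((ℋ.fibV (f.vertexMap w)).map (cV w).1.arrow))
    (hz : ∀ e', z e' ∈ Set.range ((ℋ.fibE (f.edgeMap e')).map (cE e').1.arrow)) :
    (BObj.toCovObj A).GlueCondition f y z := by
  refine ⟨fun b' w h' => ?_⟩
  obtain ⟨q, hq⟩ := hz (𝒢.graph.edgeOf b')
  rw [← hq]
  refine (BObj.toCovObj_clV_eq_iff A _ _ _).mpr ?_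
  have hmem := BObj.glue_castPtE_mem_range_of_fac A (f.abuts_branchMap b' w h') (f.edgeOf_branchMap b')
    (cV w).1 (cE (𝒢.graph.edgeOf b')).1 (hfac b' w h') q
  rw [range_map_arrow_eq_orbit (ℋ.fibV (f.vertexMap w)) (cV w) (hy w)] at hmem
  have hmem' : ∃ σ : Aut (ℋ.fibV (f.vertexMap w)), σ • y w = _ := MulAction.mem_orbit_iff.mp hmem
  obtain ⟨σ, hσ⟩ := hmem'
  exact MulAction.mem_orbit_iff.mpr ⟨σ⁻¹, by rw [← hσ, inv_smul_smul]⟩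

/-- **Vertices of the covering ↔ vertex-orbits**: `w ↦ (f w, [y_w])` is a bijection onto the vertices
`Σ v, Orbits(F_v(S_v))` of the covering semi-graph of `toCovObj A` (the labels `w ↦ (f w, cV w)` are
bijective onto `Σ v, π₀(S_v)`, and components ↔ orbits, L1b). [cite: MochizukiSemiAnbd2006, Def. 2.2(i) p.23] -/
theorem pointLift_vertex_bijective
    (hbijV : Function.Bijective (fun w : 𝒢.graph.Vertex =>
      (⟨f.vertexMap w, cV w⟩ : Σ v, π₀Obj (A.S v))))
    (hy : ∀ w, y w ∈ Set.range ((ℋ.fibV (f.vertexMap w)).map (cV w).1.arrow)) :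
    Function.Bijective (fun w : 𝒢.graph.Vertex =>
      (⟨f.vertexMap w, BTemp.cl ((BObj.toCovObj A).SV (f.vertexMap w)) (y w)⟩ :
        Σ v, BTemp.Orbits ((BObj.toCovObj A).SV v))) := by
  classical
  have hΨ := fun v : ℋ.graph.Vertex => exists_orbitOfComponent_bijective (ℋ.fibV v) (A.S v)
  choose Ψ hΨbij hΨcl using hΨ
  have hyΨ : ∀ w, BTemp.cl ((BObj.toCovObj A).SV (f.vertexMap w)) (y w) = Ψ (f.vertexMap w) (cV w) :=
    fun w => (hΨcl (f.vertexMap w) (cV w) (y w) (hy w)).symm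
  have aux₁ : ∀ (v v' : ℋ.graph.Vertex) (P : π₀Obj (A.S v)) (P' : π₀Obj (A.S v')),
      (⟨v, Ψ v P⟩ : Σ v, BTemp.Orbits ((BObj.toCovObj A).SV v)) = ⟨v', Ψ v' P'⟩ →
        (⟨v, P⟩ : Σ v, π₀Obj (A.S v)) = ⟨v', P'⟩ := by
    intro v v' P P' h
    obtain ⟨rfl, h2⟩ := Sigma.mk.inj_iff.mp h
    rw [(hΨbij v).1 (eq_of_heq h2)]
  have aux₂ : ∀ (v v' : ℋ.graph.Vertex) (P : π₀Obj (A.S v)) (P' : π₀Obj (A.S v')),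
      (⟨v, P⟩ : Σ v, π₀Obj (A.S v)) = ⟨v', P'⟩ →
        (⟨v, Ψ v P⟩ : Σ v, BTemp.Orbits ((BObj.toCovObj A).SV v)) = ⟨v', Ψ v' P'⟩ := by
    intro v v' P P' h
    cases h
    rfl
  refine ⟨fun w w' hww => hbijV.1 (aux₁ _ _ _ _ ?_), fun x => ?_⟩
  · have hww' : (⟨f.vertexMap w, BTemp.cl ((BObj.toCovObj A).SV (f.vertexMap w)) (y w)⟩ :
        Σ v, BTemp.Orbits ((BObj.toCovObj A).SV v)) = ⟨f.vertexMap w', BTemp.cl _ (y w')⟩ := hww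
    rwa [hyΨ w, hyΨ w'] at hww'
  · obtain ⟨v, ω⟩ := x
    obtain ⟨P, hP⟩ := (hΨbij v).2 ω
    obtain ⟨w, hw⟩ := hbijV.2 ⟨v, P⟩
    refine ⟨w, ?_⟩
    change (⟨f.vertexMap w, BTemp.cl ((BObj.toCovObj A).SV (f.vertexMap w)) (y w)⟩ :
        Σ v, BTemp.Orbits ((BObj.toCovObj A).SV v)) = ⟨v, ω⟩
    rw [hyΨ w, aux₂ _ _ _ _ hw, hP]

/-- **Edges of the covering ↔ edge-orbits**: `e' ↦ (f e', [z_{e'}])` is a bijection onto the edges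
`Σ e, Orbits(F_e(T_e))` of the covering semi-graph of `toCovObj A`. [cite: MochizukiSemiAnbd2006, Def. 2.2(i) p.23] -/
theorem pointLift_edge_bijective
    (hbijE : Function.Bijective (fun e' : 𝒢.graph.Edge =>
      (⟨f.edgeMap e', cE e'⟩ : Σ e, π₀Obj (A.T e))))
    (hz : ∀ e', z e' ∈ Set.range ((ℋ.fibE (f.edgeMap e')).map (cE e').1.arrow)) :
    Function.Bijective (fun e' : 𝒢.graph.Edge =>
      (⟨f.edgeMap e', BTemp.cl ((BObj.toCovObj A).SE (f.edgeMap e')) (z e')⟩ :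
        Σ e, BTemp.Orbits ((BObj.toCovObj A).SE e))) := by
  classical
  have hΨ := fun e : ℋ.graph.Edge => exists_orbitOfComponent_bijective (ℋ.fibE e) (A.T e)
  choose Ψ hΨbij hΨcl using hΨ
  have hzΨ : ∀ e', BTemp.cl ((BObj.toCovObj A).SE (f.edgeMap e')) (z e') = Ψ (f.edgeMap e') (cE e') :=
    fun e' => (hΨcl (f.edgeMap e') (cE e') (z e') (hz e')).symm
  have aux₁ : ∀ (e e₁ : ℋ.graph.Edge) (P : π₀Obj (A.T e)) (P' : π₀Obj (A.T e₁)),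
      (⟨e, Ψ e P⟩ : Σ e, BTemp.Orbits ((BObj.toCovObj A).SE e)) = ⟨e₁, Ψ e₁ P'⟩ →
        (⟨e, P⟩ : Σ e, π₀Obj (A.T e)) = ⟨e₁, P'⟩ := by
    intro e e₁ P P' h
    obtain ⟨rfl, h2⟩ := Sigma.mk.inj_iff.mp h
    rw [(hΨbij e).1 (eq_of_heq h2)]
  have aux₂ : ∀ (e e₁ : ℋ.graph.Edge) (P : π₀Obj (A.T e)) (P' : π₀Obj (A.T e₁)),
      (⟨e, P⟩ : Σ e, π₀Obj (A.T e)) = ⟨e₁, P'⟩ →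
        (⟨e, Ψ e P⟩ : Σ e, BTemp.Orbits ((BObj.toCovObj A).SE e)) = ⟨e₁, Ψ e₁ P'⟩ := by
    intro e e₁ P P' h
    cases h
    rfl
  refine ⟨fun a b hab => hbijE.1 (aux₁ _ _ _ _ ?_), fun x => ?_⟩
  · have hab' : (⟨f.edgeMap a, BTemp.cl ((BObj.toCovObj A).SE (f.edgeMap a)) (z a)⟩ :
        Σ e, BTemp.Orbits ((BObj.toCovObj A).SE e)) = ⟨f.edgeMap b, BTemp.cl _ (z b)⟩ := hab
    rwa [hzΨ a, hzΨ b] at hab'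
  · obtain ⟨e, ω⟩ := x
    obtain ⟨P, hP⟩ := (hΨbij e).2 ω
    obtain ⟨e', he'⟩ := hbijE.2 ⟨e, P⟩
    refine ⟨e', ?_⟩
    change (⟨f.edgeMap e', BTemp.cl ((BObj.toCovObj A).SE (f.edgeMap e')) (z e')⟩ :
        Σ e, BTemp.Orbits ((BObj.toCovObj A).SE e)) = ⟨e, ω⟩
    rw [hzΨ e', aux₂ _ _ _ _ he', hP]

/-! ### Packaged for `Hom.IsFiniteEtaleCoveringOf` -/

variable (φ : HomOver 𝒢 ℋ f)

/-- **Def. 2.2 (i) on the profinite presentation, packaged.**  If `φ` is the finite étale covering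
attached to `A ∈ B(ℋ)` (`Hom.IsFiniteEtaleCoveringOf`), there is a system of points `y_w ∈ F_{f w}(S)`,
`z_{e'} ∈ F_{f e'}(T)` of `toCovObj A` over `f` such that: (1) the vertex / edge homomorphisms of the
profinite reading `φ.toProfinite` (B2) are injective with images the stabilisers of `y_w` / `z_{e'}`
(L1a); (2) the gluing condition holds; (3) the lift `CovObj.pointLift` is bijective on vertices and on
edges, hence (`f` being proper) an ISOMORPHISM of semi-graphs `𝒢.graph ≅ 𝔾_{toCovObj A}` over `f`.
[cite: MochizukiSemiAnbd2006, Def. 2.2(i) p.23] -/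
theorem exists_pointLiftIso_of_isFiniteEtaleCoveringOf (hφ : φ.toHom.IsFiniteEtaleCoveringOf A) :
    ∃ (y : ∀ w : 𝒢.graph.Vertex, (ℋ.fibV (f.vertexMap w)).obj (A.S (f.vertexMap w)))
      (z : ∀ e' : 𝒢.graph.Edge, (ℋ.fibE (f.edgeMap e')).obj (A.T (f.edgeMap e')))
      (hglue : (BObj.toCovObj A).GlueCondition f y z),
      (∀ w, Function.Injective (φ.hVProfinite w) ∧
        (φ.hVProfinite w).toMonoidHom.range = MulAction.stabilizer (Aut (ℋ.fibV (f.vertexMap w))) (y w)) ∧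
      (∀ e', Function.Injective (φ.hEAt e' (f.edgeMap e') rfl) ∧
        (φ.hEAt e' (f.edgeMap e') rfl).toMonoidHom.range =
          MulAction.stabilizer (Aut (ℋ.fibE (f.edgeMap e'))) (z e')) ∧
      SemiGraph.IsProper f ∧
      Function.Bijective ((BObj.toCovObj A).pointLift f y z hglue).vertexMap ∧
      Function.Bijective ((BObj.toCovObj A).pointLift f y z hglue).edgeMap := by
  obtain ⟨hprop, cV, cE, hbijV, hbijE, hV, hE, hfac⟩ := hφ
  change ∀ w, π₀Obj (A.S (f.vertexMap w)) at cV
  change ∀ e', π₀Obj (A.T (f.edgeMap e')) at cE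
  -- the points of L1a, in the fibre-images of the labelled components
  have hy : ∀ w, ∃ y : (ℋ.fibV (f.vertexMap w)).obj (A.S (f.vertexMap w)),
      y ∈ Set.range ((ℋ.fibV (f.vertexMap w)).map (cV w).1.arrow) ∧
      Function.Injective (φ.hVProfinite w) ∧
        (φ.hVProfinite w).toMonoidHom.range =
          MulAction.stabilizer (Aut (ℋ.fibV (f.vertexMap w))) y := fun w => by
    obtain ⟨α, hα, ⟨e⟩⟩ := hV w
    have hmono : Mono (cV w).1.arrow := inferInstance
    obtain ⟨hinj, -⟩ :=
      @hVOfPath_injective_and_exists_range_eq_stabilizer _ _ _ φ w _ α hα e (φ.vertexPath w)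
    obtain ⟨y, hy, hrange⟩ :=
      @hVOfPath_exists_range_eq_stabilizer_of_mono _ _ _ φ w _ _ (cV w).1.arrow hmono α hα e
        (φ.vertexPath w)
    exact ⟨y, hy, hinj, hrange⟩
  have hz : ∀ e', ∃ z : (ℋ.fibE (f.edgeMap e')).obj (A.T (f.edgeMap e')),
      z ∈ Set.range ((ℋ.fibE (f.edgeMap e')).map (cE e').1.arrow) ∧
      Function.Injective (φ.hEAt e' (f.edgeMap e') rfl) ∧
        (φ.hEAt e' (f.edgeMap e') rfl).toMonoidHom.range =
          MulAction.stabilizer (Aut (ℋ.fibE (f.edgeMap e'))) z := fun e' => by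
    obtain ⟨α, hα, ⟨e⟩⟩ := hE e'
    have hmono : Mono (cE e').1.arrow := inferInstance
    obtain ⟨hinj, -⟩ :=
      @hEOfPath_injective_and_exists_range_eq_stabilizer _ _ _ φ e' (f.edgeMap e') rfl _ α hα e
        (φ.edgePath e' (f.edgeMap e') rfl)
    obtain ⟨z, hz, hrange⟩ :=
      @hEOfPath_exists_range_eq_stabilizer_of_mono _ _ _ φ e' (f.edgeMap e') rfl _ _ (cE e').1.arrow
        hmono α hα e (φ.edgePath e' (f.edgeMap e') rfl)
    exact ⟨z, hz, hinj, hrange⟩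
  choose y hy hVinj hVrange using hy
  choose z hz hEinj hErange using hz
  have hglue : (BObj.toCovObj A).GlueCondition f y z := glueCondition_toCovObj cV cE y z hfac hy hz
  exact ⟨y, z, hglue, fun w => ⟨hVinj w, hVrange w⟩, fun e' => ⟨hEinj e', hErange e'⟩, hprop,
    ((BObj.toCovObj A).pointLift_vertexMap_bijective_iff f y z hglue).mpr
      (pointLift_vertex_bijective cV y hbijV hy),
    ((BObj.toCovObj A).pointLift_edgeMap_bijective_iff f y z hglue).mpr
      (pointLift_edge_bijective cE z hbijE hz)⟩

end HomOver

end SemiGraphOfAnabelioids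

end Literature.AnabelianGeometry.SemiGraphs

end
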